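import Literature.MathematicalPhysics.QuantumChemistry.SingletRestrictedRelaxation
import Literature.MathematicalPhysics.QuantumChemistry.RelaxationEnergyHierarchy
import Mathlib.Topology.EMetricSpace.Lipschitz
import HarnessLib

/-!
# Ventures/CertifiedQuantumChemistry — Rows/RelaxationValueConcavity.lean: the two-positivity values are
# CONCAVE and LIPSCHITZ functions of the integral tables (hence of `U` and of `t` on the Hubbard files)

HONEST FRAMING (verbatim): certified bounds for a stated model Hamiltonian in a stated basis; not a
claim about the real molecule beyond that model.

Seat rdm-B (gen 21), ROWS file: theorems only (no `def`, no notation), zero compute, nothing landed is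
touched; the typer's adopt / refactor / retire word applies. Words-only input to `HOME/STRUCTURE.md` §2
scope note / Q1 ("`OPT_X(L;U)` is only the value function of an SDP with data affine in `(t, U)` —
semi-algebraic, piecewise analytic") and 2.1 (d) ("smoothness in `U` between decades (no kink)"): along any
LINE in table space `T(s) = T₀ + s·T₁` (`T = (h, g, h_nuc)`; the half-filled Hubbard files are the line
`U ↦ (−t·A, U·δ, 0)` at fixed `t`, and `t ↦ …` at fixed `U`) every programme value of the tree —
`pqgEnergy` / `pqgSectorEnergy` (the cell's `DQG` instances) / `pqgSingletEnergy` (`DQG+S²`) /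
`pqgT1T2pSectorEnergy` (`DQGT1T2′`) / `pqgT1T2pSingletEnergy` (`DQGT1T2′+S²`) — is a CONCAVE function of
`s` (an infimum of affine functions of `s` over an `s`-independent feasible set) and LIPSCHITZ with an
explicit constant (the a-priori bound of the functional of `T₁` on the feasible set, typer's
`norm_rdmEnergy_le_of_isDQGFeasible`). Consequences the file does NOT spell out (standard real analysis):
one-sided derivatives exist everywhere, kinks can only bend downwards, differentiability fails at most
countably often — constraints any Puiseux / change-of-optimal-face scenario of Q1 must respect. The exact
sector energy `E₀` is concave in `s` by the same mechanism (variational principle); that side is NOT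
typed here.

* §1 `rdmEnergy_line` — `E_{T₀ + s T₁}(γ, Γ) = E_{T₀}(γ, Γ) + s·E_{T₁}(γ, Γ)` (linearity of the functional
  in the tables); `rdmEnergy_sub_rdmEnergy`.
* §2 CONCAVITY along lines: `concaveOn_pqgEnergy_line`, **`concaveOn_pqgSectorEnergy_line`**,
  **`concaveOn_pqgSingletEnergy_line`**, `concaveOn_pqgT1T2pSectorEnergy_line`,
  `concaveOn_pqgT1T2pSingletEnergy_line` (real parameter `s`, complex direction tables allowed).
* §3 LIPSCHITZ in the tables: **`abs_pqgSectorEnergy_sub_le`** (`|E_PQG(T; a, b) − E_PQG(T′; a, b)| ≤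
  2N Σ‖h − h′‖ + 2N(N−1) Σ‖g − g′‖ + ‖h_nuc − h′_nuc‖`, `N = a + b`) and the same for the other four values;
  `abs_pqgSectorEnergy_line_sub_le` / `lipschitzWith_pqgSectorEnergy_line` and the singlet twins
  (Lipschitz with constant `2N Σ‖h₁‖ + 2N(N−1) Σ‖g₁‖ + ‖c₁‖`, hence continuous, along every line).

Everything is PROVED (0 sorry, standard axioms); no definitions, no named facts; nothing asserts a bound
about any model; no claim node / hint / row / CERTIFIED cell depends on it.

References: M. Nakata, B. J. Braams, K. Fujisawa, M. Fukuda, J. K. Percus, M. Yamashita, Z. Zhao, J. Chem.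
Phys. 128 (2008) 164113 §II.A, §II.D (the value as a minimum of a linear objective over a fixed convex set;
SDP form); R. T. Rockafellar, *Convex Analysis* (Princeton 1970) Thm 5.5 (pointwise infimum of affine
functions is concave) and Thm 10.4 (finite convex functions are locally Lipschitz) — here with an explicit
global constant from the bounded feasible set; D. A. Mazziotti, Adv. Chem. Phys. 134 (2007) ch. 3
§II.A–B, §II.F. Tree (REUSED): `rdmEnergy`, `IsDQGFeasible(.norm_one_apply_le)`,
`norm_rdmEnergy_le_of_isDQGFeasible`, the six `…EnergySet_bddBelow` / `…Set_nonempty` lemmas and the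
`…_le_rdmEnergy` lemmas of `RelaxationEnergyHierarchy` / `SingletRestrictedRelaxation` (typer). Mathlib:
`ConcaveOn`, `LipschitzWith.of_dist_le_mul`, `Complex.abs_re_le_norm`.
-/

noncomputable section

namespace Summit.Ventures.CertifiedQuantumChemistry

open Matrix Finset
open Literature.MathematicalPhysics.QuantumLattice Literature.MathematicalPhysics.QuantumChemistry
open scoped ComplexOrder NNReal

variable {Λ : Type*} [LinearOrder Λ] [Fintype Λ]

/-! ### §1 The functional is linear in the tables -/

section Linear

variable (h₀ h₁ : Λ → Λ → ℂ) (g₀ g₁ : Λ → Λ → Λ → Λ → ℂ) (c₀ c₁ : ℂ)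

omit [LinearOrder Λ] in
/-- **Linearity of the energy functional in the integral tables**, along a line `T₀ + s·T₁`:
`E_{h₀ + s h₁, g₀ + s g₁, c₀ + s c₁}(γ, Γ) = E_{h₀,g₀,c₀}(γ, Γ) + s · E_{h₁,g₁,c₁}(γ, Γ)`. -/
theorem rdmEnergy_line (s : ℂ) (γ : Matrix (Orb Λ) (Orb Λ) ℂ) (Γ : Matrix (Orb Λ × Orb Λ) (Orb Λ × Orb Λ) ℂ) :
    rdmEnergy (h₀ + s • h₁) (g₀ + s • g₁) (c₀ + s * c₁) γ Γ =
      rdmEnergy h₀ g₀ c₀ γ Γ + s * rdmEnergy h₁ g₁ c₁ γ Γ := by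
  unfold rdmEnergy
  simp only [Pi.add_apply, Pi.smul_apply, smul_eq_mul, add_mul, Finset.sum_add_distrib, mul_add,
    Finset.mul_sum]
  ring_nf

omit [LinearOrder Λ] in
/-- The difference of the functionals of two table triples is the functional of the difference. -/
theorem rdmEnergy_sub_rdmEnergy (h h' : Λ → Λ → ℂ) (g g' : Λ → Λ → Λ → Λ → ℂ) (c c' : ℂ)
    (γ : Matrix (Orb Λ) (Orb Λ) ℂ) (Γ : Matrix (Orb Λ × Orb Λ) (Orb Λ × Orb Λ) ℂ) :
    rdmEnergy h g c γ Γ - rdmEnergy h' g' c' γ Γ = rdmEnergy (h - h') (g - g') (c - c') γ Γ := by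
  unfold rdmEnergy
  simp only [Pi.sub_apply, sub_mul, Finset.sum_sub_distrib, mul_sub]
  ring

end Linear

/-! ### §2 Concavity of the values along lines in table space -/

section Concave

variable (h₀ h₁ : Λ → Λ → ℂ) (g₀ g₁ : Λ → Λ → Λ → Λ → ℂ) (c₀ c₁ : ℂ)

omit [LinearOrder Λ] in
/-- Generic: the infimum of `Re E_{T₀ + sT₁}` over a FIXED non-empty set of pairs on which it is bounded
below is concave in the real parameter `s`. -/
private theorem concaveOn_sInf_line
    (P : Matrix (Orb Λ) (Orb Λ) ℂ → Matrix (Orb Λ × Orb Λ) (Orb Λ × Orb Λ) ℂ → Prop)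
    (hne : ∀ (h : Λ → Λ → ℂ) (g : Λ → Λ → Λ → Λ → ℂ) (c : ℂ),
      {E : ℝ | ∃ γ Γ, P γ Γ ∧ E = (rdmEnergy h g c γ Γ).re}.Nonempty)
    (hbdd : ∀ (h : Λ → Λ → ℂ) (g : Λ → Λ → Λ → Λ → ℂ) (c : ℂ),
      BddBelow {E : ℝ | ∃ γ Γ, P γ Γ ∧ E = (rdmEnergy h g c γ Γ).re}) :
    ConcaveOn ℝ Set.univ fun s : ℝ =>
      sInf {E : ℝ | ∃ γ Γ, P γ Γ ∧
        E = (rdmEnergy (h₀ + (s : ℂ) • h₁) (g₀ + (s : ℂ) • g₁) (c₀ + (s : ℂ) * c₁) γ Γ).re} := by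
  refine ⟨convex_univ, fun s _ s' _ a b ha hb hab => ?_⟩
  dsimp only
  refine le_csInf (hne _ _ _) ?_
  rintro E ⟨γ, Γ, hf, rfl⟩
  have h1 : sInf {E : ℝ | ∃ γ Γ, P γ Γ ∧
      E = (rdmEnergy (h₀ + (s : ℂ) • h₁) (g₀ + (s : ℂ) • g₁) (c₀ + (s : ℂ) * c₁) γ Γ).re} ≤
      (rdmEnergy (h₀ + (s : ℂ) • h₁) (g₀ + (s : ℂ) • g₁) (c₀ + (s : ℂ) * c₁) γ Γ).re :=
    csInf_le (hbdd _ _ _) ⟨γ, Γ, hf, rfl⟩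
  have h2 : sInf {E : ℝ | ∃ γ Γ, P γ Γ ∧
      E = (rdmEnergy (h₀ + (s' : ℂ) • h₁) (g₀ + (s' : ℂ) • g₁) (c₀ + (s' : ℂ) * c₁) γ Γ).re} ≤
      (rdmEnergy (h₀ + (s' : ℂ) • h₁) (g₀ + (s' : ℂ) • g₁) (c₀ + (s' : ℂ) * c₁) γ Γ).re :=
    csInf_le (hbdd _ _ _) ⟨γ, Γ, hf, rfl⟩
  rw [rdmEnergy_line, Complex.add_re, Complex.re_ofReal_mul] at h1 h2
  simp only [smul_eq_mul]
  rw [Complex.ofReal_add, Complex.ofReal_mul, Complex.ofReal_mul,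
    show ((a : ℂ) * (s : ℂ) + (b : ℂ) * (s' : ℂ)) = (((a * s + b * s' : ℝ)) : ℂ) by push_cast; ring,
    rdmEnergy_line, Complex.add_re, Complex.re_ofReal_mul]
  set e₀ := (rdmEnergy h₀ g₀ c₀ γ Γ).re
  set e₁ := (rdmEnergy h₁ g₁ c₁ γ Γ).re
  have ha1 := mul_le_mul_of_nonneg_left h1 ha
  have hb2 := mul_le_mul_of_nonneg_left h2 hb
  have key : a * (e₀ + s * e₁) + b * (e₀ + s' * e₁) = e₀ + (a * s + b * s') * e₁ := by
    calc a * (e₀ + s * e₁) + b * (e₀ + s' * e₁) = (a + b) * e₀ + (a * s + b * s') * e₁ := by ring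
      _ = e₀ + (a * s + b * s') * e₁ := by rw [hab, one_mul]
  linarith

/-- **`E_PQG(N)` is concave along every line in table space** (`N ≤ 2|Λ|`). -/
theorem concaveOn_pqgEnergy_line {N : ℕ} (hN : N ≤ Fintype.card (Orb Λ)) :
    ConcaveOn ℝ Set.univ fun s : ℝ =>
      pqgEnergy (h₀ + (s : ℂ) • h₁) (g₀ + (s : ℂ) • g₁) (c₀ + (s : ℂ) * c₁) N :=
  concaveOn_sInf_line h₀ h₁ g₀ g₁ c₀ c₁ (IsDQGFeasible N) (fun h g c => pqgEnergySet_nonempty h g c hN)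
    fun h g c => pqgEnergySet_bddBelow h g c N

/-- **`E_PQG(a, b)` — the cell's `S_z`-sector DQG value — is concave along every line in table space**
(`a, b ≤ |Λ|`); in particular `U ↦ OPT_DQG(L; U)` and `t ↦ OPT_DQG` on the Hubbard files are concave. -/
theorem concaveOn_pqgSectorEnergy_line {a b : ℕ} (ha : a ≤ Fintype.card Λ) (hb : b ≤ Fintype.card Λ) :
    ConcaveOn ℝ Set.univ fun s : ℝ =>
      pqgSectorEnergy (h₀ + (s : ℂ) • h₁) (g₀ + (s : ℂ) • g₁) (c₀ + (s : ℂ) * c₁) a b :=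
  concaveOn_sInf_line h₀ h₁ g₀ g₁ c₀ c₁ (IsDQGFeasibleSector a b)
    (fun h g c => pqgSectorEnergySet_nonempty h g c ha hb) fun h g c => pqgSectorEnergySet_bddBelow h g c a b

/-- **`E_PQG(2n, S = 0)` — the cell's `DQG+S²` value — is concave along every line in table space**
(`n ≤ |Λ|`). -/
theorem concaveOn_pqgSingletEnergy_line {n : ℕ} (hn : n ≤ Fintype.card Λ) :
    ConcaveOn ℝ Set.univ fun s : ℝ =>
      pqgSingletEnergy (h₀ + (s : ℂ) • h₁) (g₀ + (s : ℂ) • g₁) (c₀ + (s : ℂ) * c₁) n :=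
  concaveOn_sInf_line h₀ h₁ g₀ g₁ c₀ c₁ (IsDQGFeasibleSinglet n)
    (fun h g c => pqgSingletEnergySet_nonempty h g c hn) fun h g c => pqgSingletEnergySet_bddBelow h g c n

/-- **`E_PQGT1T2′(a, b)` is concave along every line in table space** (`a, b ≤ |Λ|`). -/
theorem concaveOn_pqgT1T2pSectorEnergy_line {a b : ℕ} (ha : a ≤ Fintype.card Λ)
    (hb : b ≤ Fintype.card Λ) :
    ConcaveOn ℝ Set.univ fun s : ℝ =>
      pqgT1T2pSectorEnergy (h₀ + (s : ℂ) • h₁) (g₀ + (s : ℂ) • g₁) (c₀ + (s : ℂ) * c₁) a b :=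
  concaveOn_sInf_line h₀ h₁ g₀ g₁ c₀ c₁ (IsDQGT1T2PrimeFeasibleSector a b)
    (fun h g c => pqgT1T2pSectorEnergySet_nonempty h g c ha hb)
    fun h g c => pqgT1T2pSectorEnergySet_bddBelow h g c a b

/-- **`E_PQGT1T2′(2n, S = 0)` is concave along every line in table space** (`n ≤ |Λ|`). -/
theorem concaveOn_pqgT1T2pSingletEnergy_line {n : ℕ} (hn : n ≤ Fintype.card Λ) :
    ConcaveOn ℝ Set.univ fun s : ℝ =>
      pqgT1T2pSingletEnergy (h₀ + (s : ℂ) • h₁) (g₀ + (s : ℂ) • g₁) (c₀ + (s : ℂ) * c₁) n :=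
  concaveOn_sInf_line h₀ h₁ g₀ g₁ c₀ c₁ (IsDQGT1T2PrimeFeasibleSinglet n)
    (fun h g c => pqgT1T2pSingletEnergySet_nonempty h g c hn)
    fun h g c => pqgT1T2pSingletEnergySet_bddBelow h g c n

end Concave

/-! ### §3 Lipschitz dependence on the tables -/

section Lipschitz

variable (h h' : Λ → Λ → ℂ) (g g' : Λ → Λ → Λ → Λ → ℂ) (c c' : ℂ)

/-- Generic: if `P`-feasible pairs are DQG-feasible at `N`, the infimum of `Re E_T` over the (fixed,
non-empty) `P`-feasible set moves by at most the a-priori bound of `E_{T − T′}` when `T` moves to `T′`. -/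
private theorem abs_sInf_sub_sInf_le {N : ℕ}
    (P : Matrix (Orb Λ) (Orb Λ) ℂ → Matrix (Orb Λ × Orb Λ) (Orb Λ × Orb Λ) ℂ → Prop)
    (hP : ∀ γ Γ, P γ Γ → IsDQGFeasible N γ Γ)
    (hne : ∀ (h : Λ → Λ → ℂ) (g : Λ → Λ → Λ → Λ → ℂ) (c : ℂ),
      {E : ℝ | ∃ γ Γ, P γ Γ ∧ E = (rdmEnergy h g c γ Γ).re}.Nonempty)
    (hbdd : ∀ (h : Λ → Λ → ℂ) (g : Λ → Λ → Λ → Λ → ℂ) (c : ℂ),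
      BddBelow {E : ℝ | ∃ γ Γ, P γ Γ ∧ E = (rdmEnergy h g c γ Γ).re}) :
    |sInf {E : ℝ | ∃ γ Γ, P γ Γ ∧ E = (rdmEnergy h g c γ Γ).re} -
        sInf {E : ℝ | ∃ γ Γ, P γ Γ ∧ E = (rdmEnergy h' g' c' γ Γ).re}| ≤
      (∑ p, ∑ q, ‖h p q - h' p q‖) * (2 * N) +
        (1 / 2) * (∑ p, ∑ q, ∑ r, ∑ s, ‖g p q r s - g' p q r s‖) * (4 * ((N : ℝ) * ((N : ℝ) - 1))) +
        ‖c - c'‖ := by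
  set B := (∑ p, ∑ q, ‖h p q - h' p q‖) * (2 * N) +
    (1 / 2) * (∑ p, ∑ q, ∑ r, ∑ s, ‖g p q r s - g' p q r s‖) * (4 * ((N : ℝ) * ((N : ℝ) - 1))) + ‖c - c'‖
  -- pointwise: `|Re E_T(x) − Re E_T'(x)| ≤ B` on the feasible set
  have hpt : ∀ γ Γ, P γ Γ → |(rdmEnergy h g c γ Γ).re - (rdmEnergy h' g' c' γ Γ).re| ≤ B := by
    intro γ Γ hf
    rw [← Complex.sub_re, rdmEnergy_sub_rdmEnergy]
    exact (Complex.abs_re_le_norm _).trans (norm_rdmEnergy_le_of_isDQGFeasible _ _ _ (hP γ Γ hf))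
  rw [abs_sub_le_iff]
  constructor
  · rw [sub_le_iff_le_add]
    have : sInf {E : ℝ | ∃ γ Γ, P γ Γ ∧ E = (rdmEnergy h g c γ Γ).re} - B ≤
        sInf {E : ℝ | ∃ γ Γ, P γ Γ ∧ E = (rdmEnergy h' g' c' γ Γ).re} := by
      refine le_csInf (hne _ _ _) ?_
      rintro E ⟨γ, Γ, hf, rfl⟩
      have h1 := csInf_le (hbdd h g c) ⟨γ, Γ, hf, rfl⟩
      have h2 := (abs_sub_le_iff.1 (hpt γ Γ hf)).1
      linarith
    linarith
  · rw [sub_le_iff_le_add]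
    have : sInf {E : ℝ | ∃ γ Γ, P γ Γ ∧ E = (rdmEnergy h' g' c' γ Γ).re} - B ≤
        sInf {E : ℝ | ∃ γ Γ, P γ Γ ∧ E = (rdmEnergy h g c γ Γ).re} := by
      refine le_csInf (hne _ _ _) ?_
      rintro E ⟨γ, Γ, hf, rfl⟩
      have h1 := csInf_le (hbdd h' g' c') ⟨γ, Γ, hf, rfl⟩
      have h2 := (abs_sub_le_iff.1 (hpt γ Γ hf)).2
      linarith
    linarith

/-- **`E_PQG(N)` is Lipschitz in the tables**:
`|E_PQG(h,g,c; N) − E_PQG(h′,g′,c′; N)| ≤ 2N Σ‖h − h′‖ + 2N(N−1) Σ‖g − g′‖ + ‖c − c′‖` (`N ≤ 2|Λ|`). -/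
theorem abs_pqgEnergy_sub_le {N : ℕ} (hN : N ≤ Fintype.card (Orb Λ)) :
    |pqgEnergy h g c N - pqgEnergy h' g' c' N| ≤
      (∑ p, ∑ q, ‖h p q - h' p q‖) * (2 * N) +
        (1 / 2) * (∑ p, ∑ q, ∑ r, ∑ s, ‖g p q r s - g' p q r s‖) * (4 * ((N : ℝ) * ((N : ℝ) - 1))) +
        ‖c - c'‖ :=
  abs_sInf_sub_sInf_le h h' g g' c c' (IsDQGFeasible N) (fun _ _ hf => hf)
    (fun h g c => pqgEnergySet_nonempty h g c hN) fun h g c => pqgEnergySet_bddBelow h g c N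

/-- **`E_PQG(a, b)` is Lipschitz in the tables** (`a, b ≤ |Λ|`, `N = a + b`). -/
theorem abs_pqgSectorEnergy_sub_le {a b : ℕ} (ha : a ≤ Fintype.card Λ) (hb : b ≤ Fintype.card Λ) :
    |pqgSectorEnergy h g c a b - pqgSectorEnergy h' g' c' a b| ≤
      (∑ p, ∑ q, ‖h p q - h' p q‖) * (2 * ((a + b : ℕ) : ℝ)) +
        (1 / 2) * (∑ p, ∑ q, ∑ r, ∑ s, ‖g p q r s - g' p q r s‖) *
          (4 * (((a + b : ℕ) : ℝ) * (((a + b : ℕ) : ℝ) - 1))) + ‖c - c'‖ :=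
  abs_sInf_sub_sInf_le h h' g g' c c' (IsDQGFeasibleSector a b) (fun _ _ hf => hf.dqg)
    (fun h g c => pqgSectorEnergySet_nonempty h g c ha hb) fun h g c => pqgSectorEnergySet_bddBelow h g c a b

/-- **`E_PQG(2n, S = 0)` is Lipschitz in the tables** (`n ≤ |Λ|`, `N = 2n`). -/
theorem abs_pqgSingletEnergy_sub_le {n : ℕ} (hn : n ≤ Fintype.card Λ) :
    |pqgSingletEnergy h g c n - pqgSingletEnergy h' g' c' n| ≤
      (∑ p, ∑ q, ‖h p q - h' p q‖) * (2 * ((n + n : ℕ) : ℝ)) +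
        (1 / 2) * (∑ p, ∑ q, ∑ r, ∑ s, ‖g p q r s - g' p q r s‖) *
          (4 * (((n + n : ℕ) : ℝ) * (((n + n : ℕ) : ℝ) - 1))) + ‖c - c'‖ :=
  abs_sInf_sub_sInf_le h h' g g' c c' (IsDQGFeasibleSinglet n) (fun _ _ hf => hf.dqg)
    (fun h g c => pqgSingletEnergySet_nonempty h g c hn) fun h g c => pqgSingletEnergySet_bddBelow h g c n

/-- **`E_PQGT1T2′(a, b)` is Lipschitz in the tables** (`a, b ≤ |Λ|`). -/
theorem abs_pqgT1T2pSectorEnergy_sub_le {a b : ℕ} (ha : a ≤ Fintype.card Λ) (hb : b ≤ Fintype.card Λ) :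
    |pqgT1T2pSectorEnergy h g c a b - pqgT1T2pSectorEnergy h' g' c' a b| ≤
      (∑ p, ∑ q, ‖h p q - h' p q‖) * (2 * ((a + b : ℕ) : ℝ)) +
        (1 / 2) * (∑ p, ∑ q, ∑ r, ∑ s, ‖g p q r s - g' p q r s‖) *
          (4 * (((a + b : ℕ) : ℝ) * (((a + b : ℕ) : ℝ) - 1))) + ‖c - c'‖ :=
  abs_sInf_sub_sInf_le h h' g g' c c' (IsDQGT1T2PrimeFeasibleSector a b) (fun _ _ hf => hf.dqg)
    (fun h g c => pqgT1T2pSectorEnergySet_nonempty h g c ha hb)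
    fun h g c => pqgT1T2pSectorEnergySet_bddBelow h g c a b

/-- **`E_PQGT1T2′(2n, S = 0)` is Lipschitz in the tables** (`n ≤ |Λ|`). -/
theorem abs_pqgT1T2pSingletEnergy_sub_le {n : ℕ} (hn : n ≤ Fintype.card Λ) :
    |pqgT1T2pSingletEnergy h g c n - pqgT1T2pSingletEnergy h' g' c' n| ≤
      (∑ p, ∑ q, ‖h p q - h' p q‖) * (2 * ((n + n : ℕ) : ℝ)) +
        (1 / 2) * (∑ p, ∑ q, ∑ r, ∑ s, ‖g p q r s - g' p q r s‖) *
          (4 * (((n + n : ℕ) : ℝ) * (((n + n : ℕ) : ℝ) - 1))) + ‖c - c'‖ :=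
  abs_sInf_sub_sInf_le h h' g g' c c' (IsDQGT1T2PrimeFeasibleSinglet n) (fun _ _ hf => hf.dqg)
    (fun h g c => pqgT1T2pSingletEnergySet_nonempty h g c hn)
    fun h g c => pqgT1T2pSingletEnergySet_bddBelow h g c n

end Lipschitz

/-! ### §3′ Lipschitz continuity along lines (explicit constant) -/

section Line

variable (h₀ h₁ : Λ → Λ → ℂ) (g₀ g₁ : Λ → Λ → Λ → Λ → ℂ) (c₀ c₁ : ℂ)

omit [LinearOrder Λ] in
/-- The table difference along a line: `Σ‖(T₀ + sT₁) − (T₀ + s′T₁)‖ = |s − s′| Σ‖T₁‖`, one-electron part. -/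
private theorem sum_norm_line_sub_one (s s' : ℝ) :
    ∑ p, ∑ q, ‖(h₀ + (s : ℂ) • h₁) p q - (h₀ + (s' : ℂ) • h₁) p q‖ = |s - s'| * ∑ p, ∑ q, ‖h₁ p q‖ := by
  simp only [Pi.add_apply, Pi.smul_apply, smul_eq_mul, add_sub_add_left_eq_sub, ← sub_mul, norm_mul,
    ← Complex.ofReal_sub, Complex.norm_real, Real.norm_eq_abs, Finset.mul_sum]

omit [LinearOrder Λ] in
/-- The same for the two-electron part. -/
private theorem sum_norm_line_sub_two (s s' : ℝ) :
    ∑ p, ∑ q, ∑ r, ∑ u, ‖(g₀ + (s : ℂ) • g₁) p q r u - (g₀ + (s' : ℂ) • g₁) p q r u‖ =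
      |s - s'| * ∑ p, ∑ q, ∑ r, ∑ u, ‖g₁ p q r u‖ := by
  simp only [Pi.add_apply, Pi.smul_apply, smul_eq_mul, add_sub_add_left_eq_sub, ← sub_mul, norm_mul,
    ← Complex.ofReal_sub, Complex.norm_real, Real.norm_eq_abs, Finset.mul_sum]

/-- The constant part. -/
private theorem norm_line_sub_const (s s' : ℝ) :
    ‖(c₀ + (s : ℂ) * c₁) - (c₀ + (s' : ℂ) * c₁)‖ = |s - s'| * ‖c₁‖ := by
  rw [add_sub_add_left_eq_sub, ← sub_mul, norm_mul, ← Complex.ofReal_sub, Complex.norm_real,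
    Real.norm_eq_abs]

omit [LinearOrder Λ] in
/-- The Lipschitz constant of a line is non-negative. -/
private theorem lineLipschitzConst_nonneg (N : ℕ) :
    0 ≤ (∑ p, ∑ q, ‖h₁ p q‖) * (2 * (N : ℝ)) +
      (1 / 2) * (∑ p, ∑ q, ∑ r, ∑ u, ‖g₁ p q r u‖) * (4 * ((N : ℝ) * ((N : ℝ) - 1))) + ‖c₁‖ := by
  have hs1 : 0 ≤ ∑ p, ∑ q, ‖h₁ p q‖ :=
    Finset.sum_nonneg fun _ _ => Finset.sum_nonneg fun _ _ => norm_nonneg _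
  have hs2 : 0 ≤ ∑ p, ∑ q, ∑ r, ∑ u, ‖g₁ p q r u‖ :=
    Finset.sum_nonneg fun _ _ => Finset.sum_nonneg fun _ _ =>
      Finset.sum_nonneg fun _ _ => Finset.sum_nonneg fun _ _ => norm_nonneg _
  have hN : 0 ≤ (N : ℝ) := Nat.cast_nonneg N
  have hNN : 0 ≤ (N : ℝ) * ((N : ℝ) - 1) := by
    rcases Nat.eq_zero_or_pos N with hz | hpos
    · rw [hz, Nat.cast_zero, zero_mul]
    · have h1 : (1 : ℝ) ≤ (N : ℝ) := by exact_mod_cast hpos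
      exact mul_nonneg hN (by linarith)
  have hA : 0 ≤ (∑ p, ∑ q, ‖h₁ p q‖) * (2 * (N : ℝ)) := mul_nonneg hs1 (by linarith)
  have hB : 0 ≤ (1 / 2) * (∑ p, ∑ q, ∑ r, ∑ u, ‖g₁ p q r u‖) * (4 * ((N : ℝ) * ((N : ℝ) - 1))) :=
    mul_nonneg (mul_nonneg (by norm_num) hs2) (by linarith)
  linarith [norm_nonneg c₁]

/-- A real function with `|f s − f s′| ≤ B |s − s′|`, `B ≥ 0`, is `B`-Lipschitz. -/
private theorem lipschitzWith_of_abs_sub_le {f : ℝ → ℝ} {B : ℝ} (hB : 0 ≤ B)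
    (hf : ∀ s s', |f s - f s'| ≤ B * |s - s'|) : LipschitzWith (Real.toNNReal B) f :=
  LipschitzWith.of_dist_le_mul fun s s' => by
    rw [Real.dist_eq, Real.dist_eq, Real.coe_toNNReal _ hB]
    exact hf s s'

/-- **`s ↦ E_PQG(T₀ + sT₁; a, b)` moves at most linearly**: `|E_PQG(T₀ + sT₁; a, b) − E_PQG(T₀ + s′T₁; a, b)|
≤ (2N Σ‖h₁‖ + 2N(N−1) Σ‖g₁‖ + ‖c₁‖) · |s − s′|` (`N = a + b`; `a, b ≤ |Λ|`). -/
theorem abs_pqgSectorEnergy_line_sub_le {a b : ℕ} (ha : a ≤ Fintype.card Λ) (hb : b ≤ Fintype.card Λ)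
    (s s' : ℝ) :
    |pqgSectorEnergy (h₀ + (s : ℂ) • h₁) (g₀ + (s : ℂ) • g₁) (c₀ + (s : ℂ) * c₁) a b -
        pqgSectorEnergy (h₀ + (s' : ℂ) • h₁) (g₀ + (s' : ℂ) • g₁) (c₀ + (s' : ℂ) * c₁) a b| ≤
      ((∑ p, ∑ q, ‖h₁ p q‖) * (2 * ((a + b : ℕ) : ℝ)) +
        (1 / 2) * (∑ p, ∑ q, ∑ r, ∑ u, ‖g₁ p q r u‖) * (4 * (((a + b : ℕ) : ℝ) * (((a + b : ℕ) : ℝ) - 1))) +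
        ‖c₁‖) * |s - s'| := by
  have hB := abs_pqgSectorEnergy_sub_le (h₀ + (s : ℂ) • h₁) (h₀ + (s' : ℂ) • h₁) (g₀ + (s : ℂ) • g₁)
    (g₀ + (s' : ℂ) • g₁) (c₀ + (s : ℂ) * c₁) (c₀ + (s' : ℂ) * c₁) ha hb
  rw [sum_norm_line_sub_one, sum_norm_line_sub_two, norm_line_sub_const] at hB
  refine hB.trans (le_of_eq ?_)
  ring

/-- **`s ↦ E_PQG(T₀ + sT₁; a, b)` is Lipschitz**, hence continuous: the cell's `S_z`-sector DQG value is a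
Lipschitz function of `U` (and of `t`) on the Hubbard files. -/
theorem lipschitzWith_pqgSectorEnergy_line {a b : ℕ} (ha : a ≤ Fintype.card Λ) (hb : b ≤ Fintype.card Λ) :
    LipschitzWith
      (Real.toNNReal ((∑ p, ∑ q, ‖h₁ p q‖) * (2 * ((a + b : ℕ) : ℝ)) +
        (1 / 2) * (∑ p, ∑ q, ∑ r, ∑ u, ‖g₁ p q r u‖) * (4 * (((a + b : ℕ) : ℝ) * (((a + b : ℕ) : ℝ) - 1))) +
        ‖c₁‖))
      fun s : ℝ => pqgSectorEnergy (h₀ + (s : ℂ) • h₁) (g₀ + (s : ℂ) • g₁) (c₀ + (s : ℂ) * c₁) a b :=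
  lipschitzWith_of_abs_sub_le (lineLipschitzConst_nonneg h₁ g₁ c₁ (a + b))
    (abs_pqgSectorEnergy_line_sub_le h₀ h₁ g₀ g₁ c₀ c₁ ha hb)

/-- **`s ↦ E_PQG(T₀ + sT₁; 2n, S = 0)` moves at most linearly** (same constant, `N = 2n`, `n ≤ |Λ|`). -/
theorem abs_pqgSingletEnergy_line_sub_le {n : ℕ} (hn : n ≤ Fintype.card Λ) (s s' : ℝ) :
    |pqgSingletEnergy (h₀ + (s : ℂ) • h₁) (g₀ + (s : ℂ) • g₁) (c₀ + (s : ℂ) * c₁) n -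
        pqgSingletEnergy (h₀ + (s' : ℂ) • h₁) (g₀ + (s' : ℂ) • g₁) (c₀ + (s' : ℂ) * c₁) n| ≤
      ((∑ p, ∑ q, ‖h₁ p q‖) * (2 * ((n + n : ℕ) : ℝ)) +
        (1 / 2) * (∑ p, ∑ q, ∑ r, ∑ u, ‖g₁ p q r u‖) * (4 * (((n + n : ℕ) : ℝ) * (((n + n : ℕ) : ℝ) - 1))) +
        ‖c₁‖) * |s - s'| := by
  have hB := abs_pqgSingletEnergy_sub_le (h₀ + (s : ℂ) • h₁) (h₀ + (s' : ℂ) • h₁) (g₀ + (s : ℂ) • g₁)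
    (g₀ + (s' : ℂ) • g₁) (c₀ + (s : ℂ) * c₁) (c₀ + (s' : ℂ) * c₁) hn
  rw [sum_norm_line_sub_one, sum_norm_line_sub_two, norm_line_sub_const] at hB
  refine hB.trans (le_of_eq ?_)
  ring

/-- **`s ↦ E_PQG(T₀ + sT₁; 2n, S = 0)` is Lipschitz**, hence continuous: the cell's `DQG+S²` value is a
Lipschitz function of `U` (and of `t`) on the Hubbard files. -/
theorem lipschitzWith_pqgSingletEnergy_line {n : ℕ} (hn : n ≤ Fintype.card Λ) :
    LipschitzWith
      (Real.toNNReal ((∑ p, ∑ q, ‖h₁ p q‖) * (2 * ((n + n : ℕ) : ℝ)) +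
        (1 / 2) * (∑ p, ∑ q, ∑ r, ∑ u, ‖g₁ p q r u‖) * (4 * (((n + n : ℕ) : ℝ) * (((n + n : ℕ) : ℝ) - 1))) +
        ‖c₁‖))
      fun s : ℝ => pqgSingletEnergy (h₀ + (s : ℂ) • h₁) (g₀ + (s : ℂ) • g₁) (c₀ + (s : ℂ) * c₁) n :=
  lipschitzWith_of_abs_sub_le (lineLipschitzConst_nonneg h₁ g₁ c₁ (n + n))
    (abs_pqgSingletEnergy_line_sub_le h₀ h₁ g₀ g₁ c₀ c₁ hn)

end Line

end Summit.Ventures.CertifiedQuantumChemistry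

end
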